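import Summits.RiemannHypothesis.RiemannHypothesis.Theorems.UniversalFactorMediumHighDefs

/-!
# The linear-factor ray at Lehmer's pair — certified `LehmerWindowData` (definitions)

Cell rh-split (D-0116 arm), ENGINE 5 (rh-splitx-eng-5 g4), cell TARGET T14: the numerical data
`LehmerWindowData a` of `Theorems/UniversalFactorLinearRayLehmerWindow.lean` (scale-free dip data at
`x₀ = 2t₀`, `t₀ = 7005.08`, typed by seat dbn-neg g2) for the DERIVATIVE-FREE two-point certificate
`Theorems/Splittings/LinearRayTwoPoint.lean` against the linear-factor ray
`HasOnlyRealZeros (linearFactorH a)` of `Literature/Barriers/RiemannHypothesis/NewmanConjecture.lean`.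
Everything is read off the EXISTING high-window engine of crux `MediumKernelNoGo`
(`UniversalFactorMediumHigh*.lean`: certified `ζ` evaluator `lehmerFBox`, Gauss–Legendre cells
`hiPointData`, interval re-weighting `hiSideSum`, error and tail constants `hiSideErr`/`hiTails`), in the
engine's `K₀`-free units (`K₀ = lehmerK0 t₀`, the common unevaluated scale `κ` of the certificate):
* `ldQ` — the forward average bound `q` of an `a`-box: `K₀·q ≤ Q_a(x₀) = ∫₀^∞ H_0(x₀+y)e^{−ay} dy`
  (the engine's side-`Q` sum with its margin RETURNED instead of sign-tested);
* `ldBoxCheck`/`ldCoverCheck`/`ldQRunWith`/`ldQRun` — per box `0 ≤ q` and the margin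
  `L·M < e^{−a₂L}·q` against given rationals `M` (dip bound) and `L = Ln/Ld` (window length);
* `ldDipVals`/`ldMaxReHi`/`ldDipConsts`/`ldDipCheck`/`ldDipRunWith`/`ldDipRun` — the dip side: boxes of
  `F_0(½+it_k)` on the grid `t_k = (N₁+k)/B`, `k ≤ G`, `t_G = t₀`, the uniform Cauchy slack
  `4h²M*` (`h = 1/B`, `|F_0''| ≤ 2M*/R²`, `R = ¼`) and the `10⁻⁶` representation term, tested against `M`,
  plus the sign `Re F_0(½+it₁) + 10⁻⁶‖F_0(½+it₁)‖ < 0` at `t₁ = N₁/B` (`⇒ H_0(2t₁) > 0`).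
* `ldAsLow`/`ldAsHigh` — the box breakpoints of the two compiled forward-average checks.
DEFINITIONS only; soundness in `LinearRayLehmerWindowQ.lean` / `LinearRayLehmerWindowDip.lean`, the compiled
certificates and the window theorem in `LinearRayLehmerWindowCert*.lean` / `LinearRayLehmerWindow.lean`.
HONEST LABEL: the ray is RH-strengthening (`riemannHypothesis_of_exists_linearRay`); refuting it on a
window is RH-free bookkeeping for the C15 census; nothing here bears on the truth of RH.
-/

set_option linter.dupNamespace false

namespace Summit.RiemannHypothesis.RiemannHypothesis.Theorems.Splittings.LinearRayLehmerWindow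

open Literature.NumberTheory.LFunctions Literature.NumberTheory.LFunctions.ZetaNumerics
open Literature.Analysis.ValidatedNumerics Literature.Analysis.ValidatedNumerics.NumericsMP

/-! ## The forward average of a box -/

/-- The forward-average bound of the box `[A₁/AD, A₂/AD]` (`K₀`-free units):
`q = −(2·(hi(sQ)/S + eQ) + tQ)` with `sQ` the interval-weighted node sum of the forward cells,
`eQ` their error constants and `tQ` the tail constant at `a₁`; `CyB` backward cells are carried (as in
the engine's `hiBoxCheck`) but unused — the compiled checks take `CyB = 0`. [folklore] -/
def ldQ (C : UniversalFactor.LCtx) (pt : UniversalFactor.HiPoint) (CyB CyF A₁ A₂ AD : ℕ) : Option ℚ :=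
  let S := C.T.S
  match UniversalFactor.hiBoxTabs S pt.ρD CyB CyF A₁ A₂ AD,
    UniversalFactor.hiSideErr S pt.ρD true A₁ A₂ AD pt.fwd CyF,
    UniversalFactor.hiTails C pt.ρD CyB CyF A₁ AD with
  | some ((_EcB1, _EcB2, _EnB1, _EnB2), (EcF1, EcF2, EnF1, EnF2)), some eQ, some (_tP, tQ) =>
    some (-(2 * (((UniversalFactor.hiSideSum S pt.ρD pt.fwd EnF1 EnF2 EcF1 EcF2 CyF).hi : ℚ) / S + eQ) + tQ))
  | _, _, _ => none

/-- A lower bound (scaled by `S`) of `e^{−(A₂/AD)·(Ln/Ld)}`. [folklore] -/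
def ldExpLo (S A₂ AD Ln Ld : ℕ) : Option ℤ :=
  match MI.exp S UniversalFactor.KEXP UniversalFactor.hiKexp (MI.ofFrac S (-(((A₂ * Ln : ℕ) : ℤ))) (AD * Ld)) with
  | some E => some E.lo
  | none => none

/-- **The box check**: `0 ≤ q` and the margin `(Ln/Ld)·M < e^{−a₂·Ln/Ld}·q` (lower end of the
exponential). [folklore] -/
def ldBoxCheck (C : UniversalFactor.LCtx) (pt : UniversalFactor.HiPoint) (CyB CyF A₁ A₂ AD Ln Ld : ℕ) (M : ℚ) : Bool :=
  match ldQ C pt CyB CyF A₁ A₂ AD, ldExpLo C.T.S A₂ AD Ln Ld with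
  | some q, some e => decide (0 ≤ q) && decide ((Ln : ℚ) / Ld * M < (e : ℚ) / C.T.S * q)
  | _, _ => false

/-- **The cover check** over consecutive boxes `[As[k], As[k+1]]/AD` with the static guards
(`ρD ≥ 8`, `2·CyB, 2·CyF ≤ 10ρD + 1`, `AD > 0`, `≥ 2` breakpoints, `Ld > 0`, `0 ≤ M`, every `a₁ ≥ 1`).
[folklore] -/
def ldCoverCheck (C : UniversalFactor.LCtx) (pt : UniversalFactor.HiPoint) (CyB CyF : ℕ) (As : List ℕ)
    (AD Ln Ld : ℕ) (M : ℚ) : Bool :=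
  decide (8 ≤ pt.ρD ∧ 2 * CyB ≤ 10 * pt.ρD + 1 ∧ 2 * CyF ≤ 10 * pt.ρD + 1 ∧ 0 < AD ∧ 2 ≤ As.length ∧ 0 < Ld ∧ 0 ≤ M) &&
  (List.range (As.length - 1)).all fun k =>
    decide (AD ≤ As.getD k 0) && ldBoxCheck C pt CyB CyF (As.getD k 0) (As.getD (k + 1) 0) AD Ln Ld M

/-- The whole forward-average check from optional tables. [folklore] -/
def ldQRunWith (oT : Option Tables) (ρD CyB CyF : ℕ) (As : List ℕ) (AD Ln Ld : ℕ) (M : ℚ) : Bool :=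
  match oT with
  | none => false
  | some T =>
    match UniversalFactor.mkCtx T 140 UniversalFactor.lehmerT0N UniversalFactor.lehmerT0D with
    | none => false
    | some C =>
      match UniversalFactor.hiPointData C ρD CyB CyF with
      | none => false
      | some pt => ldCoverCheck C pt CyB CyF As AD Ln Ld M

/-- **The forward-average check** on the engine's tables `lehmerTables` (no backward cells). [folklore] -/
def ldQRun (ρD CyF : ℕ) (As : List ℕ) (AD Ln Ld : ℕ) (M : ℚ) : Bool :=
  ldQRunWith UniversalFactor.lehmerTables ρD 0 CyF As AD Ln Ld M

/-! ## The dip -/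

/-- Boxes of `F_κ(½ + it_k)`, `t_k = (N₁ + k)/B`, for `k < n` (the checks take `κ = 0`). [folklore] -/
def ldDipVals (C : UniversalFactor.LCtx) (B N₁ : ℕ) (κ : ℤ) : ℕ → Option (List MC)
  | 0 => some []
  | k + 1 =>
    (ldDipVals C B N₁ κ k).bind fun L =>
      (UniversalFactor.lehmerFBox C (N₁ + k) B κ).map fun F => L ++ [F]

/-- The maximum of the upper real parts of a list of boxes, floored at `0` (scaled by `S`). [folklore] -/
def ldMaxReHi : List MC → ℤ
  | [] => 0
  | F :: L => max F.re.hi (ldMaxReHi L)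

/-- The uniform constants of the dip segment `[t₁, t₀]`, `t₁ = N₁/B` (exact rationals, `K₀`-free units):
`(M*, Mseg)` with `M* ≥ 5(t₀+1)³ exp(¼ + (log t₀ + 3)/8 + D₀)` (sup of `‖F_0‖` on the discs of radius
`¼` about the segment) and `Mseg ≥ 25.3 (t₀+1)² exp(D₀)` (sup of `‖F_0‖` on the segment), where
`D₀ ≥ Re F(¼+it₁/2) − Re F(¼+it₀/2)` (`F = stirlingPrim`). [folklore] -/
def ldDipConsts (C : UniversalFactor.LCtx) (B N₁ : ℕ) : Option (ℚ × ℚ) :=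
  (UniversalFactor.spOf C.T.S C.Klog C.T.piI N₁ B).bind fun P =>
  (MI.logNat C.T.S C.Klog UniversalFactor.lehmerT0N).bind fun LN =>
  (MI.logNat C.T.S C.Klog UniversalFactor.lehmerT0D).bind fun LD =>
  (MI.exp C.T.S UniversalFactor.KEXP UniversalFactor.hiKexp
    ((((MI.ofFrac C.T.S 1 4).add (((LN.sub LD).add (MI.ofInt C.T.S 3)).divNat 8)).add (P.1.sub C.reSP0)))).bind fun EM =>
  (MI.exp C.T.S UniversalFactor.KEXP UniversalFactor.hiKexp (P.1.sub C.reSP0)).map fun ES =>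
    (5 * ((((UniversalFactor.lehmerT0N : ℚ) + UniversalFactor.lehmerT0D) / UniversalFactor.lehmerT0D) ^ 3) * ((EM.hi : ℚ) / C.T.S),
     253 / 10 * ((((UniversalFactor.lehmerT0N : ℚ) + UniversalFactor.lehmerT0D) / UniversalFactor.lehmerT0D) ^ 2) * ((ES.hi : ℚ) / C.T.S))

/-- **The dip bound check** (`n` values `t_0 … t_{n−1}`, the runs take `n = G + 1`, `κ = 0`) with the static
guards `B > 0`, `4B ≤ N₁`, `(N₁ + G)·t0D = t0N·B` (i.e. `t_G = t₀`), `G ≤ 10B`, `1 ≤ G`, `n = G + 1`: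
the total `max(0, max_k hi Re F(½+it_k))/S + 4M*/B² + Mseg/10⁶ ≤ M` and the sign at `t₁`:
`10⁶·hi Re F(½+it₁) + absHi F(½+it₁) < 0`. [folklore] -/
def ldDipCheck (C : UniversalFactor.LCtx) (B N₁ G n : ℕ) (κ : ℤ) (M : ℚ) : Bool :=
  decide (0 < B ∧ 4 * B ≤ N₁ ∧ (N₁ + G) * UniversalFactor.lehmerT0D = UniversalFactor.lehmerT0N * B ∧ G ≤ 10 * B ∧
    1 ≤ G ∧ n = G + 1) &&
  match ldDipVals C B N₁ κ n, ldDipConsts C B N₁ with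
  | some vals, some cs =>
    decide (((ldMaxReHi vals : ℚ) / C.T.S) + 4 * cs.1 / ((B : ℚ) ^ 2) + cs.2 / 10 ^ 6 ≤ M) &&
    decide (10 ^ 6 * (vals.getD 0 ⟨⟨0, 0⟩, ⟨0, 0⟩⟩).re.hi + (vals.getD 0 ⟨⟨0, 0⟩, ⟨0, 0⟩⟩).absHi < 0)
  | _, _ => false

/-- The dip check from optional tables. [folklore] -/
def ldDipRunWith (oT : Option Tables) (B N₁ G n : ℕ) (κ : ℤ) (M : ℚ) : Bool :=
  match oT with
  | none => false
  | some T =>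
    match UniversalFactor.mkCtx T 140 UniversalFactor.lehmerT0N UniversalFactor.lehmerT0D with
    | none => false
    | some C => ldDipCheck C B N₁ G n κ M

/-- **The dip check** on the engine's tables `lehmerTables` (`n = G + 1` values, `κ = 0`). [folklore] -/
def ldDipRun (B N₁ G : ℕ) (M : ℚ) : Bool :=
  ldDipRunWith UniversalFactor.lehmerTables B N₁ G (G + 1) 0 M

/-! ## Data of the compiled checks -/

/-- The breakpoints of the low window (over `1000`): boxes `[1, 5/4, 3/2, 2, 5/2, 3, 7/2, 4]`. [folklore] -/
def ldAsLow : List ℕ := [1000, 1250, 1500, 2000, 2500, 3000, 3500, 4000]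

/-- The breakpoints of the high window (over `1000`): boxes `[4, 5, …, 20, 41/2, 21]`. [folklore] -/
def ldAsHigh : List ℕ :=
  [4000, 5000, 6000, 7000, 8000, 9000, 10000, 11000, 12000, 13000, 14000, 15000, 16000, 17000, 18000,
   19000, 20000, 20500, 21000]

end Summit.RiemannHypothesis.RiemannHypothesis.Theorems.Splittings.LinearRayLehmerWindow
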